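import Summits.BirchSwinnertonDyer.BirchSwinnertonDyer.Theorems.KolyvaginRankRigidityAtTwoTransverseClassAtTwo
import Summits.BirchSwinnertonDyer.BirchSwinnertonDyer.Theorems.Rank1ResidualJetLocalTransverse
import Summits.BirchSwinnertonDyer.BirchSwinnertonDyer.Theorems.GenusKolyvaginAtTwoEquivariantKolyvaginExactAtTwoKolyvaginPrimeDictionary
import Summits.BirchSwinnertonDyer.BirchSwinnertonDyer.Theorems.GenusKolyvaginAtTwoEquivariantKolyvaginExactAtTwoCebotarevVisibleRat
import Summits.BirchSwinnertonDyer.Rank1Residual.X11b.RingClassFieldConj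
import Literature.NumberTheory.EllipticCurves.RingClassFieldConjugation
import Literature.NumberTheory.EllipticCurves.TransverseConditionGaloisTransport
import Literature.NumberTheory.EllipticCurves.HeegnerPointsKolyvaginLocalCriterion
import Literature.NumberTheory.GaloisRepresentations.FrobeniusPlaces
import HarnessLib

/-!
# Route `GenusKolyvaginAtTwo`, crux L_T `PowDvdShaCardAtTwoRT` (stmt-BirchSwinnertonDyer-23242), LINE 18 stub KS, bottom rung —
# THE K-SIDE OF THE (V44)-SOCKET `hTr`: a TRANSVERSE class kills the square of a ℚ-Frobenius at its own prime
# («`[c_k(n′), τ_{F²}]_K = 0`», Howard's Lemma 2.7.3 at `2` READ AT AN ELEMENT)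

Seat `bsd-line-gk2-p3` g24 (PROVER seat 3/3, cell `bsd-f1-sign2`), `--supports stmt-BirchSwinnertonDyer-23242` (helper; closes nothing).
THEOREMS ONLY (no definition, no named fact, no `sorry`).  BSD is NOT proved by any of this; neither is the crux nor stub KS.

WHY.  The bottom rung of the KS assembly (`RelaxedCount.hbot_socket_margin`, gk2-p5 g24; LEAD's
`exists_deep_primitive_of_gross_witness'`) displays ONE local socket `hTr` at every deep own prime `ℓ ∣ n′`: for a ℚ-class `Z` over
`E[4]` with `res_K Z = c₂(n′)` and an arithmetic Frobenius `F ∈ Γ_ℚ` above `ℓ` acting on `E[4]` as complex conjugation, `[2•Z, F]` is an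
`F`-coboundary value.  LEAD g18 (`…RTBottomRungTransverseReduction`, §2–§3) reduced it to the K-SIDE VALUE STATEMENT «`[c₂(n′), τ] = 0`
for the `τ ∈ Γ_K` restricting to `F·F`» and left that «for a JET-fluent seat».  This file and its sequel prove it, for every level `2^k` and
every own prime of index `≥ k + 1`; here: the two inputs «a TRANSVERSE class kills every `τ ∈ Γ_{K(E[2^k])}` of a decomposition group
above `ℓ` fixing `K[ℓ]`» (§1–§3) and «`τ_{F²}` fixes `K[ℓ]`» (§4, the dihedral input).

HOW (all inputs are tree theorems).
* §1 `h1Eval_absGaloisRestrict_eq_zero_of_mem_transverseSubgroup` — COCYCLE READING of the transverse condition: if `loc_v c` lies in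
  `ker(H¹(K_v, E[n]) → H¹(E_{w'}, E[n]))` then the chosen cocycle of `c` is PRINCIPAL on the image of `Γ_{E_{w'}} → Γ_{K_v}`
  (`oneCocycleClass_mem_transverseSubgroup_iff`), which is `{d : d|_{K̄} fixes ι(E)}` (Cassels–Fröhlich VII §1.1,
  `SemiLocal.mem_range_absGaloisRestrict_adicCompletion_iff`); at such a `d` fixing `E[n]` the value is `d m − m = 0`.
* §2 `exists_absGaloisRestrict_eq_conj_of_mem_decompositionSubgroup` — an element of a decomposition group above `v` is, up to
  `Γ_K`-conjugacy, the restriction of an element of `Γ_{K_v}` (transitivity `exists_smul_eq_of_mem_primesAbove_holds` + Neukirch II (9.6)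
  `exists_apply_eq_smul_of_mem_decompositionSubgroup`); with `[c, σgσ⁻¹] = σ[c, g]` (`h1Eval_conj`) and `Γ_K`-stability of `ι(E)` for
  `E/ℚ` normal (`exists_ringEquiv_apply_algHom_eq_of_normal`): `h1Eval_eq_zero_of_transverse`.
* §3 `h1Eval_kolyvaginClass_eq_zero_of_fixes_ringClassField` — Howard's Lemma 2.7.3 at `2`, margin one
  (`JET.kolyvaginClass_mem_transverseKer_two`, UNCONDITIONAL), moved to the local route by `JET.localization_mem_transverseSubgroup_iff`.
* §4 THE DIHEDRAL INPUT `smul_algHom_ringClassField_eq_of_absGaloisRestrict_eq_sq`: `τ_{F²}` FIXES `K[ℓ]`.  `F ∉ res Γ_K` because `ℓ`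
  is INERT (a Frobenius in `res Γ_K` forces residue degree `1`, `inertiaDeg_eq_one_of_isArithFrobAt_absGaloisRestrict`, against
  `inertiaDeg_eq_two_of_span_isPrime`); so `F|_{K[ℓ]} ∉ 𝒢_ℓ = Gal(K[ℓ]/K)` and, `Gal(K[ℓ]/ℚ)` being generalised dihedral
  (`exists_conj_algEquiv`, `mul_mul_inv_eq_inv_of_not_mem_ringClassGal`), `F|_{K[ℓ]}` is an involution
  (`mul_self_eq_one_of_not_mem_ringClassGal`): `F²|_{K[ℓ]} = 1`.  The restriction to `K[ℓ]` runs through the chosen `ℚ̄ ≅ K̄`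
  (`absClosureEmbedding`, bijective for `K/ℚ` algebraic) and Mathlib's `AlgEquiv.restrictNormalHom`.
Consumer: `…RTBottomRungTransverseSocket` (this seat, next file): the assembly «`[c_k(n′), τ_{F²}]_K = 0`» (transport of `F ∈ D_𝔓` to
`τ ∈ D_𝔔` along `ι : \bar ℤ_ℚ ≅ \bar ℤ_K`, `comap_decompositionSubgroup_comap_absIntegersMap`) and `hTr` VERBATIM through LEAD's §2/§3.

References: [Howard2004HeegnerKolyvagin] Lemma 2.7.3; [McCallumLMS1991] §4 Prop. 4.4 (1), §5 proof of Prop. 5.2 (13);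
[GrossLMS1991] §3 (p. 238: `K_n/ℚ` dihedral), §4 (4.4)–(4.6); [Jetchev2008] §2 (Notation), §3.1.2 (p. 814); [Cox2013] Lemma 9.3;
[NeukirchANT1999] Ch. I §9 (9.1)–(9.6), Ch. II §9 (9.6); [CasselsFrohlichANT1967] Ch. VII §1.1; [SerreGaloisCohomology1997] I §2.4, §5.1.
-/

set_option autoImplicit false
-- the Theorems namespace of this sub repeats the summit name by design (D-0017 nested layout)
set_option linter.dupNamespace false

noncomputable section

open scoped Classical Pointwise

open WeierstrassCurve NumberField IsDedekindDomain Field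
open Literature.NumberTheory.EllipticCurves Literature.NumberTheory.GaloisRepresentations
open Literature.NumberTheory.GaloisRepresentations.DiscreteGaloisModule (transverseSubgroup)
open Literature.NumberTheory.Automorphic
open Literature.NumberTheory.EllipticCurves.Jetchev2008
open Literature.NumberTheory.EllipticCurves.ModularForms
open Summit.BirchSwinnertonDyer.Rank1Residual

namespace Summit.BirchSwinnertonDyer.BirchSwinnertonDyer.Theorems.GenusExact.TransverseValue

section Local

variable {K : Type} [Field K] [NumberField K] (X : WeierstrassCurve K) (n : ℤ)
  (E : Type) [Field E] [NumberField E] [Algebra K E] [IsGalois K E] (ιE : E →ₐ[K] AlgebraicClosure K)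
  (v : HeightOneSpectrum (𝓞 K)) (w' : HeightOneSpectrum (𝓞 E)) [w'.asIdeal.LiesOver v.asIdeal]

/-- **§1 COCYCLE READING of the transverse condition.**  For a curve `X/K`, a finite Galois extension `E/K` with a `K`-embedding
`ιE : E → K̄`, a finite place `v` of `K` and a place `w' ∣ v` of `E`: if `loc_v c` lies in the `E_{w'}`-transverse subgroup
`ker(H¹(K_v, X[n]) → H¹(E_{w'}, X[n]))`, then the chosen cocycle `[c, ·]` VANISHES at every `res d`, `d ∈ Γ_{K_v}`, whose restriction to
`K̄` fixes `ιE(E)` pointwise and fixes `X[n]` (the cocycle is principal on the image of `Γ_{E_{w'}}`, which is the set of such `d`).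
[cite: CasselsFrohlichANT1967, Ch. VII §1.1] [cite: MazurRubin2004, Def. 1.1.6] [cite: SerreGaloisCohomology1997, I §5.1] -/
theorem h1Eval_absGaloisRestrict_eq_zero_of_mem_transverseSubgroup {c : galH1Torsion X n}
    (hc : letI := (adicCompletionOfLiesOver K E v w').toAlgebra
      galoisCohomology.localization (X.torsionGaloisModule n) (Sum.inr v) 1 c ∈
        transverseSubgroup (GaloisRep.toLocal v (X.torsionGaloisModule n)) (w'.adicCompletion E))
    {d : absoluteGaloisGroup (v.adicCompletion K)}
    (hdE : ∀ e : E, absGaloisRestrict K (v.adicCompletion K) d • ιE e = ιE e)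
    (hdT : absGaloisRestrict K (v.adicCompletion K) d ∈ torsionFixing X n) :
    h1Eval X n c (absGaloisRestrict K (v.adicCompletion K) d) = 0 := by
  letI := (adicCompletionOfLiesOver K E v w').toAlgebra
  set φ := reprCocycle X n c with hφ
  have hclass : oneCocycleClass _ φ = c := oneCocycleClass_reprCocycle X n c
  have hloc : galoisCohomology.localization (X.torsionGaloisModule n) (Sum.inr v) 1 c =
      oneCocycleClass (DiscreteGaloisModule.toTopRep
          (GaloisRep.toLocal v (X.torsionGaloisModule n)))
        (contOneCocycles.pullback (absGaloisRestrict K (v.adicCompletion K))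
          (TopRep.ofHom ⟨ContinuousLinearMap.id ℤ (geomTorsion X n), fun _ => rfl⟩) φ) := by
    rw [← hclass]
    exact map_oneCocycleClass _ _ _ φ
  rw [hloc] at hc
  obtain ⟨m, hm⟩ := (oneCocycleClass_mem_transverseSubgroup_iff
    (GaloisRep.toLocal v (X.torsionGaloisModule n)) (w'.adicCompletion E) _).mp hc
  have hd : d ∈ Set.range (absGaloisRestrict (v.adicCompletion K) (w'.adicCompletion E)) :=
    (SemiLocal.mem_range_absGaloisRestrict_adicCompletion_iff v ιE w' d).mpr hdE
  have h := hm d hd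
  change φ.1 (absGaloisRestrict K (v.adicCompletion K) d) = _ at h
  change φ.1 (absGaloisRestrict K (v.adicCompletion K) d) = 0
  rw [h]
  change absGaloisRestrict K (v.adicCompletion K) d • m - m = 0
  rw [smul_eq_of_mem_torsionFixing X n hdT, sub_self]

end Local

section Decomposition

variable {K : Type} [Field K] [NumberField K]

/-- **§2 From a decomposition group to the local Galois group, up to conjugacy** (Neukirch I (9.1), II (9.6)): every `τ` in the
decomposition group of a prime `𝔔 ∣ v` of `\bar ℤ_K` is conjugate in `Γ_K` to the restriction of an element of `Γ_{K_v}` along the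
chosen `K̄ → K̄_v` (move `𝔔` to the prime cut out by the chosen embedding, then Neukirch II (9.6)).
[cite: NeukirchANT1999, Ch. I §9 Prop. (9.1), Ch. II §9 Prop. (9.6)] -/
theorem exists_absGaloisRestrict_eq_conj_of_mem_decompositionSubgroup (v : HeightOneSpectrum (𝓞 K))
    {𝔔 : Ideal (absIntegers (𝓞 K) K)} (h𝔔 : 𝔔 ∈ v.primesAbove) {τ : absoluteGaloisGroup K}
    (hτ : τ ∈ 𝔔.decompositionSubgroup (absoluteGaloisGroup K)) :
    ∃ (σ : absoluteGaloisGroup K) (d : absoluteGaloisGroup (v.adicCompletion K)),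
      absGaloisRestrict K (v.adicCompletion K) d = σ * τ * σ⁻¹ := by
  obtain ⟨𝔐, h𝔐⟩ := v.localPrimesAbove_nonempty
  set ι₀ := closureEmb (K := K) (v.adicCompletion K) with hι₀
  set 𝔓₀ := v.primeBelow ι₀ 𝔐 with h𝔓₀
  have h𝔓₀ : 𝔓₀ ∈ v.primesAbove := HeightOneSpectrum.primeBelow_mem_primesAbove h𝔐
  obtain ⟨σ, hσ⟩ := HeightOneSpectrum.exists_smul_eq_of_mem_primesAbove_holds h𝔔 h𝔓₀
  have hστ : σ * τ * σ⁻¹ ∈ 𝔓₀.decompositionSubgroup (absoluteGaloisGroup K) := by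
    rw [← hσ, Ideal.decompositionSubgroup_smul]
    exact ⟨τ, hτ, rfl⟩
  obtain ⟨d, hd⟩ := exists_apply_eq_smul_of_mem_decompositionSubgroup ι₀ h𝔐 hστ
  refine ⟨σ, d, ?_⟩
  have h := resGalOfEmb_eq_of_apply_eq ι₀ hd
  rw [← resGal_eq_absGaloisRestrict, resGal_eq]
  exact h

end Decomposition

section Assembly

variable {K : Type} [Field K] [NumberField K] (X : WeierstrassCurve K) (n : ℤ)
  (E : Type) [Field E] [NumberField E] [Algebra K E] [IsGalois K E] [Normal ℚ E]
  (ιE : E →ₐ[K] AlgebraicClosure K) (v : HeightOneSpectrum (𝓞 K))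

omit [IsGalois K E] in
/-- For `E/ℚ` normal the embedded copy `ιE(E) ⊆ K̄` is `Γ_K`-stable, so the pointwise fixer of `ιE(E)` is normal in `Γ_K`.
[cite: Cox2013, Lemma 9.3] [cite: GrossLMS1991, §3] -/
theorem conj_smul_algHom_eq {τ : absoluteGaloisGroup K} (hτ : ∀ e : E, τ • ιE e = ιE e)
    (σ : absoluteGaloisGroup K) (e : E) : (σ * τ * σ⁻¹) • ιE e = ιE e := by
  obtain ⟨e', he'⟩ := exists_ringEquiv_apply_algHom_eq_of_normal ιE
    ((Field.absoluteGaloisGroup.toAlgEquiv K σ⁻¹).toRingEquiv) e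
  have h1 : σ⁻¹ • ιE e = ιE e' := he'
  rw [mul_smul, mul_smul, h1, hτ e', ← h1, smul_inv_smul]

/-- **§2 A class transverse at `v` (for `E`) kills every `τ ∈ Γ_{K(X[n])}` lying in a decomposition group above `v` and fixing `ιE(E)`.**
By `exists_absGaloisRestrict_eq_conj_of_mem_decompositionSubgroup`, `σ τ σ⁻¹ = res d` with `d ∈ Γ_{K_v}`; `res d` still fixes `ιE(E)`
(`conj_smul_algHom_eq`) and `X[n]`, so §1 gives `[c, σ τ σ⁻¹] = 0`, and `[c, σ τ σ⁻¹] = σ • [c, τ]` (`h1Eval_conj`).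
[cite: NeukirchANT1999, Ch. II §9 Prop. (9.6)] [cite: GrossLMS1991, §9 (the pairing `[s, ρ]`)] -/
theorem h1Eval_eq_zero_of_transverse {c : galH1Torsion X n}
    (hc : ∀ (w' : HeightOneSpectrum (𝓞 E)) [w'.asIdeal.LiesOver v.asIdeal],
      letI := (adicCompletionOfLiesOver K E v w').toAlgebra
      galoisCohomology.localization (X.torsionGaloisModule n) (Sum.inr v) 1 c ∈
        transverseSubgroup (GaloisRep.toLocal v (X.torsionGaloisModule n)) (w'.adicCompletion E))
    {𝔔 : Ideal (absIntegers (𝓞 K) K)} (h𝔔 : 𝔔 ∈ v.primesAbove) {τ : absoluteGaloisGroup K}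
    (hτD : τ ∈ 𝔔.decompositionSubgroup (absoluteGaloisGroup K)) (hτT : τ ∈ torsionFixing X n)
    (hτE : ∀ e : E, τ • ιE e = ιE e) :
    h1Eval X n c τ = 0 := by
  obtain ⟨σ, d, hd⟩ := exists_absGaloisRestrict_eq_conj_of_mem_decompositionSubgroup v h𝔔 hτD
  obtain ⟨w₁⟩ := (inferInstance : Nonempty (SemiLocal.Place K E v))
  haveI := SemiLocal.Place.liesOver w₁
  have hT' : σ * τ * σ⁻¹ ∈ torsionFixing X n := (torsionFixing_normal X n).conj_mem τ hτT σ
  have h0 := h1Eval_absGaloisRestrict_eq_zero_of_mem_transverseSubgroup X n E ιE v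
    (w₁ : HeightOneSpectrum (𝓞 E)) (hc _) (d := d)
    (fun e ↦ by rw [hd]; exact conj_smul_algHom_eq E ιE hτE σ e) (by rw [hd]; exact hT')
  rw [hd, h1Eval_conj X n c σ hτT] at h0
  exact (smul_eq_zero_iff_eq σ).mp h0

end Assembly

section Kolyvagin

variable {K : Type} [Field K] [NumberField K] (W : WeierstrassCurve ℚ) [W.IsElliptic] [W.IsGloballyMinimal]
  [NeZero (W.conductorNorm ℤ)]

/-- **§3 Howard's Lemma 2.7.3 at `2`, READ AT AN ELEMENT.**  For `K` imaginary quadratic with `d_K < −4`, a square-free product `c`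
of Zhang–Kolyvagin primes of index `≥ k`, the tree's datum `d` on `c` and an own prime `ℓ ∣ c` of index `≥ k + 1` (margin one): the
Kolyvagin class `c_k(c)` kills every `τ ∈ Γ_{K(E[2^k])}` lying in a decomposition group above the place `v ∋ ℓ` of `K` and fixing (a
`K`-embedded copy of) the ring class field `K[ℓ]` — `c_k(c) ∈ transverseKer ℓ` UNCONDITIONALLY (`JET.kolyvaginClass_mem_transverseKer_two`),
moved to `loc_v c_k(c) ∈ ker(H¹(K_v) → H¹(K[ℓ]_{w'}))` (`JET.localization_mem_transverseSubgroup_iff`), then §2.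
[cite: Howard2004HeegnerKolyvagin, Lemma 2.7.3] [cite: Jetchev2008, §3.1.2 (p. 814), Prop. 4.6] [cite: McCallumLMS1991, §4 Prop. 4.4 (1)] -/
theorem h1Eval_kolyvaginClass_eq_zero_of_fixes_ringClassField (hK : IsImaginaryQuadratic K)
    (hD : NumberField.discr K < -4) (Dt : ModularParametrizationData W (W.conductorNorm ℤ)) (β : ℤ)
    (ι : K →+* ℂ) [∀ j : ℕ, NumberField (ringClassField K ι j)] (k : ℕ) {c : ℕ} (hc : Squarefree c)
    (hcK : ∀ q ∈ c.primeFactors, Zhang2014.IsKolyvaginPrime (W.conductorNorm ℤ) W K 2 q ∧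
      k ≤ Zhang2014.kolyvaginIndex W 2 q)
    (d : KolyvaginHeegnerData Dt β ι c) {ℓ : ℕ} (hℓ : ℓ ∈ c.primeFactors)
    (hkℓ : k + 1 ≤ Zhang2014.kolyvaginIndex W 2 ℓ)
    (v : HeightOneSpectrum (𝓞 K)) (hℓv : (ℓ : 𝓞 K) ∈ v.asIdeal)
    {𝔔 : Ideal (absIntegers (𝓞 K) K)} (h𝔔 : 𝔔 ∈ v.primesAbove)
    (ιE : ringClassField K ι ℓ →ₐ[K] AlgebraicClosure K)
    {τ : absoluteGaloisGroup K} (hτD : τ ∈ 𝔔.decompositionSubgroup (absoluteGaloisGroup K))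
    (hτT : τ ∈ torsionFixing (W.baseChange K) ((2 ^ k : ℕ) : ℤ))
    (hτE : ∀ e : ringClassField K ι ℓ, τ • ιE e = ιE e) :
    h1Eval (W.baseChange K) ((2 ^ k : ℕ) : ℤ) (d.kolyvaginClass Nat.prime_two k) τ = 0 := by
  haveI : Fact (Nat.Prime 2) := ⟨Nat.prime_two⟩
  have hℓp : ℓ.Prime := Nat.prime_of_mem_primeFactors hℓ
  have hℓ0 : ℓ ≠ 0 := hℓp.ne_zero
  haveI : IsGalois K (ringClassField K ι ℓ) := (finiteDimensional_and_isGalois_ringClassField hK ι hℓ0).2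
  haveI : IsGalois ℚ (ringClassField K ι ℓ) := X11b.RingClassConj.isGalois_rat_ringClassField hK ι hℓ0
  have htr := JET.kolyvaginClass_mem_transverseKer_two W hK hD Dt β ι k hc hcK d hℓ hkℓ
  refine h1Eval_eq_zero_of_transverse (W.baseChange K) _ (ringClassField K ι ℓ) ιE v ?_ h𝔔 hτD hτT hτE
  intro w' hw'
  have hℓw' : (ℓ : 𝓞 (ringClassField K ι ℓ)) ∈ w'.asIdeal := by
    have h := hw'.over ▸ hℓv
    rw [Ideal.under_def, Ideal.mem_comap, map_natCast] at h
    exact h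
  exact (JET.localization_mem_transverseSubgroup_iff ((W.baseChange K).torsionGaloisModule _)
    (ringClassField K ι ℓ) v w' _).mpr ((mem_transverseKer_iff W K ι _ ℓ _).mp htr w' hℓw')

end Kolyvagin

section Dihedral

variable {K : Type} [Field K] [NumberField K]

/-- **§4 An arithmetic Frobenius at a prime INERT in the quadratic field `K` does not come from `Γ_K`** (its restriction to `K` is the
non-trivial automorphism): a Frobenius in `res(Γ_K)` forces residue degree `1` (`inertiaDeg_eq_one_of_isArithFrobAt_absGaloisRestrict`),
while `f(λ|ℓ) = 2` at an inert `ℓ` (`inertiaDeg_eq_two_of_span_isPrime`). [cite: Marcus2018, Ch. 4, Thm. 29] [cite: NeukirchANT1999, Ch. I §9 (9.4)] -/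
theorem not_exists_absGaloisRestrict_eq_of_isArithFrobAt_inert (h2K : Module.finrank ℚ K = 2) {ℓ : ℕ}
    (hℓ : ℓ.Prime) (hinert : (Ideal.span {(ℓ : 𝓞 K)}).IsPrime) {v : HeightOneSpectrum (𝓞 ℚ)}
    (hℓv : (ℓ : 𝓞 ℚ) ∈ v.asIdeal) {𝔓 : Ideal (absIntegers (𝓞 ℚ) ℚ)} (h𝔓 : 𝔓 ∈ v.primesAbove)
    {F : absoluteGaloisGroup ℚ} (hF : IsArithFrobAt (𝓞 ℚ) F 𝔓) (g : absoluteGaloisGroup K) :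
    absGaloisRestrict ℚ K g ≠ F := by
  intro hg
  haveI : Algebra.IsAlgebraic ℚ K := Algebra.IsAlgebraic.of_finite ℚ K
  haveI := h𝔓.1
  obtain ⟨𝔔, h𝔔p, h𝔔⟩ := exists_isPrime_comap_absIntegersMap_eq (F := ℚ) (M := K) 𝔓
  haveI := h𝔔p
  have h𝔔v : 𝔔.comap (absIntegersMap ℚ K) ∈ v.primesAbove := by rw [h𝔔]; exact h𝔓
  obtain ⟨w, hwv, h𝔔w, -⟩ := exists_heightOneSpectrum_of_comap_absIntegersMap_mem_primesAbove h𝔔v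
  have hℓw : (ℓ : 𝓞 K) ∈ w.asIdeal := by
    have h : (ℓ : 𝓞 ℚ) ∈ w.asIdeal.under (𝓞 ℚ) := by rw [hwv]; exact hℓv
    rw [Ideal.under_def, Ideal.mem_comap, map_natCast] at h
    exact h
  have hf2 := SelmerDescent.inertiaDeg_eq_two_of_span_isPrime h2K hℓ hinert hℓv hℓw
  have hΦ : IsArithFrobAt (𝓞 ℚ) (absGaloisRestrict ℚ K g) (𝔔.comap (absIntegersMap ℚ K)) := by
    rw [hg, h𝔔]; exact hF
  have hf1 := inertiaDeg_eq_one_of_isArithFrobAt_absGaloisRestrict hwv h𝔔w hΦ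
  omega

/-- **§4 Every automorphism of `K[n]` outside `𝒢_n = Gal(K[n]/K)` is an involution** (`Gal(K[n]/ℚ)` is generalised dihedral: with
`c` the restriction of complex conjugation, `c² = 1`, `c ∉ 𝒢_n`, `[Aut : 𝒢_n] = 2` and `c γ c⁻¹ = γ⁻¹` on `𝒢_n`, every `f ∉ 𝒢_n` is
`f = c (c f)` with `c f ∈ 𝒢_n`, whence `f² = c (cf) c (cf) = (cf)⁻¹ (cf) = 1`).
[cite: GrossLMS1991, §3 (p. 238)] [cite: Cox2013, Lemma 9.3] [cite: Jetchev2008, §2 (Notation: `K[c]` dihedral over `ℚ`)] -/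
theorem mul_self_eq_one_of_not_mem_ringClassGal (hK : IsImaginaryQuadratic K) (ι : K →+* ℂ) {n : ℕ}
    (hn : n ≠ 0) {f : ringClassField K ι n ≃ₐ[ℚ] ringClassField K ι n} (hf : f ∉ ringClassGal ι n) :
    f * f = 1 := by
  obtain ⟨c, hc⟩ := X11b.RingClassConj.exists_conj_algEquiv hK ι hn
  have hcc : c * c = 1 := X11b.RingClassConj.conj_mul_self hc
  have hcinv : c⁻¹ = c := X11b.RingClassConj.conj_inv hc
  rcases X11b.RingClassConj.mem_ringClassGal_or_conj_mul_mem hc hK f with h | h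
  · exact (hf h).elim
  · have h1 := mul_mul_inv_eq_inv_of_not_mem_ringClassGal hK ι hn
      (X11b.RingClassConj.conj_not_mem_ringClassGal hc hK) h
    -- `c (c f) c⁻¹ = (c f)⁻¹`, i.e. `f c = f⁻¹ c`
    rw [hcinv, ← mul_assoc, hcc, one_mul, mul_inv_rev, hcinv] at h1
    have h2 := mul_right_cancel h1
    calc f * f = f⁻¹ * f := by rw [← h2]
      _ = 1 := inv_mul_cancel f

/-- **§4 THE DIHEDRAL INPUT: `τ_{F²}` fixes the ring class field `K[ℓ]`.**  `K` imaginary quadratic, `ℓ` a prime INERT in `K`, `F ∈ Γ_ℚ`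
an arithmetic Frobenius at a prime above `ℓ`, and `τ ∈ Γ_K` with `res τ = F·F` (the unique such `τ`).  Then `τ` fixes any `K`-embedded
copy `ιE(K[ℓ]) ⊆ K̄` pointwise.  Through the chosen `ℚ̄ ≅ K̄` and `AlgEquiv.restrictNormalHom` (`K[ℓ]/ℚ` is Galois,
`isGalois_rat_ringClassField`): `F|_{K[ℓ]} ∉ 𝒢_ℓ` — else `F` would fix `K` and equal `res g₀` for the transported `g₀ ∈ Γ_K`, against
`not_exists_absGaloisRestrict_eq_of_isArithFrobAt_inert` — hence `(F|_{K[ℓ]})² = 1` (`mul_self_eq_one_of_not_mem_ringClassGal`) and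
`τ|_{K[ℓ]} = (F|_{K[ℓ]})² = 1`. [cite: GrossLMS1991, §3 (p. 238), §4 (proof of Lemma 4.3)] [cite: Cox2013, Lemma 9.3] -/
theorem smul_algHom_ringClassField_eq_of_absGaloisRestrict_eq_sq (hK : IsImaginaryQuadratic K) {ℓ : ℕ}
    (hℓ : ℓ.Prime) (hinert : (Ideal.span {(ℓ : 𝓞 K)}).IsPrime) {v : HeightOneSpectrum (𝓞 ℚ)}
    (hℓv : (ℓ : 𝓞 ℚ) ∈ v.asIdeal) {𝔓 : Ideal (absIntegers (𝓞 ℚ) ℚ)} (h𝔓 : 𝔓 ∈ v.primesAbove)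
    {F : absoluteGaloisGroup ℚ} (hF : IsArithFrobAt (𝓞 ℚ) F 𝔓) (ι : K →+* ℂ)
    [NumberField (ringClassField K ι ℓ)] (ιE : ringClassField K ι ℓ →ₐ[K] AlgebraicClosure K)
    {τ : absoluteGaloisGroup K} (hτ : absGaloisRestrict ℚ K τ = F * F) (e : ringClassField K ι ℓ) :
    τ • ιE e = ιE e := by
  have h2K : Module.finrank ℚ K = 2 := hK.1
  have hℓ0 : ℓ ≠ 0 := hℓ.ne_zero
  haveI : IsGalois ℚ (ringClassField K ι ℓ) := X11b.RingClassConj.isGalois_rat_ringClassField hK ι hℓ0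
  -- the chosen `ℚ̄ ≅ K̄`
  letI := absClosureAlgebra ℚ K
  haveI := absClosure_isScalarTower ℚ K
  haveI : Algebra.IsAlgebraic ℚ K := Algebra.IsAlgebraic.of_finite ℚ K
  haveI : Algebra.IsAlgebraic ℚ (AlgebraicClosure K) := Algebra.IsAlgebraic.trans ℚ K (AlgebraicClosure K)
  haveI : Algebra.IsAlgebraic (AlgebraicClosure ℚ) (AlgebraicClosure K) :=
    Algebra.IsAlgebraic.tower_top (K := ℚ) (AlgebraicClosure ℚ)
  have hbij : Function.Bijective (absClosureEmbedding ℚ K) :=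
    IsAlgClosed.algebraMap_bijective_of_isIntegral (k := AlgebraicClosure ℚ) (K := AlgebraicClosure K)
  let embE : AlgebraicClosure ℚ ≃ₐ[ℚ] AlgebraicClosure K := AlgEquiv.ofBijective (absClosureEmbedding ℚ K) hbij
  have hemb : ∀ (γ : absoluteGaloisGroup K) (y : AlgebraicClosure ℚ),
      embE (absGaloisRestrict ℚ K γ • y) = γ • embE y := fun γ y ↦ absGaloisRestrict_apply_smul ℚ K γ y
  -- `E = K[ℓ]` as a subfield of `ℚ̄` through `j = embE⁻¹ ∘ ιE`
  let j : ringClassField K ι ℓ →ₐ[ℚ] AlgebraicClosure ℚ := (embE.symm : AlgebraicClosure K →ₐ[ℚ] AlgebraicClosure ℚ).comp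
    (ιE.restrictScalars ℚ)
  have hj : ∀ x : ringClassField K ι ℓ, j x = embE.symm (ιE x) := fun _ ↦ rfl
  letI : Algebra (ringClassField K ι ℓ) (AlgebraicClosure ℚ) := j.toRingHom.toAlgebra
  haveI : IsScalarTower ℚ (ringClassField K ι ℓ) (AlgebraicClosure ℚ) :=
    IsScalarTower.of_algebraMap_eq fun q ↦ (j.commutes q).symm
  have halg : ∀ x : ringClassField K ι ℓ, algebraMap (ringClassField K ι ℓ) (AlgebraicClosure ℚ) x = j x :=
    fun _ ↦ rfl
  -- restriction of `ℚ̄`-automorphisms to the normal subextension `E/ℚ`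
  let r : (AlgebraicClosure ℚ ≃ₐ[ℚ] AlgebraicClosure ℚ) →* (ringClassField K ι ℓ ≃ₐ[ℚ] ringClassField K ι ℓ) :=
    AlgEquiv.restrictNormalHom (F := ℚ) (K₁ := AlgebraicClosure ℚ) (ringClassField K ι ℓ)
  have hres : ∀ (σ : AlgebraicClosure ℚ ≃ₐ[ℚ] AlgebraicClosure ℚ) (x : ringClassField K ι ℓ),
      j (r σ x) = σ (j x) := fun σ x ↦ by
    rw [← halg, ← halg]; exact AlgEquiv.restrictNormal_commutes σ (ringClassField K ι ℓ) x
  have hFa : ∀ y, Field.absoluteGaloisGroup.toAlgEquiv ℚ F y = F • y := fun _ ↦ rfl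
  -- `F|_E ∉ 𝒢_ℓ`: otherwise `F` would fix `K` and come from `Γ_K`
  have hf : r (Field.absoluteGaloisGroup.toAlgEquiv ℚ F) ∉ ringClassGal ι ℓ := by
    intro hfG
    have hfixK : ∀ k : K, Field.absoluteGaloisGroup.toAlgEquiv ℚ F (embE.symm (algebraMap K (AlgebraicClosure K) k)) =
        embE.symm (algebraMap K (AlgebraicClosure K) k) := by
      intro k
      have h1 := (mem_ringClassGal_iff_forall_apply_algebraMap ι ℓ _).mp hfG k
      have h2 := hres (Field.absoluteGaloisGroup.toAlgEquiv ℚ F) (algebraMap K (ringClassField K ι ℓ) k)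
      rw [h1, hj, ιE.commutes] at h2
      exact h2.symm
    let g₀ : AlgebraicClosure K ≃ₐ[K] AlgebraicClosure K :=
      { (embE.symm.trans ((Field.absoluteGaloisGroup.toAlgEquiv ℚ F).trans embE)).toRingEquiv with
        commutes' := fun k ↦ by
          change embE (Field.absoluteGaloisGroup.toAlgEquiv ℚ F (embE.symm (algebraMap K (AlgebraicClosure K) k))) =
            algebraMap K (AlgebraicClosure K) k
          rw [hfixK, AlgEquiv.apply_symm_apply] }
    have hg₀ : ∀ x, g₀ • x = embE (Field.absoluteGaloisGroup.toAlgEquiv ℚ F (embE.symm x)) := fun _ ↦ rfl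
    apply not_exists_absGaloisRestrict_eq_of_isArithFrobAt_inert h2K hℓ hinert hℓv h𝔓 hF
      ((Field.absoluteGaloisGroup.toAlgEquiv K).symm g₀)
    apply (Field.absoluteGaloisGroup.toAlgEquiv ℚ).injective
    refine AlgEquiv.ext fun y ↦ embE.injective ?_
    change embE (absGaloisRestrict ℚ K ((Field.absoluteGaloisGroup.toAlgEquiv K).symm g₀) • y) = embE (F • y)
    rw [hemb]
    change g₀ • embE y = _
    rw [hg₀, AlgEquiv.symm_apply_apply, hFa]
  -- hence `(F|_E)² = 1`, and `res τ = F²` restricts to `1`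
  have hff := mul_self_eq_one_of_not_mem_ringClassGal hK ι hℓ0 hf
  have hτres : r (Field.absoluteGaloisGroup.toAlgEquiv ℚ (absGaloisRestrict ℚ K τ)) = 1 := by
    have h1 : Field.absoluteGaloisGroup.toAlgEquiv ℚ (absGaloisRestrict ℚ K τ) =
        Field.absoluteGaloisGroup.toAlgEquiv ℚ F * Field.absoluteGaloisGroup.toAlgEquiv ℚ F := by
      rw [hτ]; rfl
    rw [h1]
    exact (map_mul r _ _).trans hff
  have hfix : j e = (absGaloisRestrict ℚ K τ) • j e := by
    have h := hres (Field.absoluteGaloisGroup.toAlgEquiv ℚ (absGaloisRestrict ℚ K τ)) e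
    rw [hτres, AlgEquiv.one_apply] at h
    exact h
  have h3 := congrArg embE hfix
  rw [hemb, hj, AlgEquiv.apply_symm_apply] at h3
  exact h3.symm

end Dihedral



end Summit.BirchSwinnertonDyer.BirchSwinnertonDyer.Theorems.GenusExact.TransverseValue

end
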